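import Mathlib
import Summits.ResolutionOfSingularities.ResolutionOfSingularities.Theorems.RadicialJungCleanModelsCleanProp44TransformNormalForm
import Summits.ResolutionOfSingularities.ResolutionOfSingularities.Theorems.RadicialJungCleanModelsCleanProp44LeafTowerStep
import HarnessLib

/-!
# Route `RadicialJung`, crux `CleanModels` (stmt-ResolutionOfSingularities-15917), line `Sketch` rev 35, stub 6 `stub_cleanProp44` (X44c):
# THE START OF THE LEAF TOWER AT A POINT OF A BLOWING UP — ✓ `…LeafTowerStep` read on the tree's `IsBlowup` (scheme side of census (iii-3) (S), first division)

Seat decomp-res-hand-2 g20 (structural hand).  ✓ `leafSum_base` / `map_leafSum_eq` (`…CleanProp44LeafTowerStep.lean`) are stated for an abstract chart map `ψ` with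
`ψ(x_k) = v·y_k`.  At a point `x′` of a blowing up `τ : X′ → X` (`IsBlowup τ J`) over `x` with `(c) = J_x` for a family `c` extending to a regular system `(c, w)`,
hand-2 g18's ✓ `exists_transform_normalForm_of_isBlowup` supplies exactly this: a chart index `i` and `uf` with `τ♯c_k = τ♯c_i · uf_k` (`uf_i = 1`).  Hence:

* `exists_chart_leafSum_of_isBlowup` — for `f = Σ_{e≤μ} c_{i₀}^e·(G_e(c) + r_e)` (`c_{i₀} = t` the leaf, `G_e` homogeneous of degree `k_e` in the centre generators
  `c`, `r_e ∈ (c)^{k_e+1}`, `μ ≤ e + k_e`): `τ♯f = e′^μ · Σ_{e≤μ} t₁^e e′^{e+k_e−μ} h_e` with `e′ = τ♯c_i`, `t₁ = uf_{i₀}` (so `τ♯t = e′·t₁`) and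
  `h_e ≡ G_e^{τ♯}(uf) (mod e′)` — the first division of memo 4e §2.5 with its dehomogenised initial forms, on the stalks of the blowing up.

With ✓ `pow_mul_mem_map_of_mem_stalkIdeal_controlledTransform` (`…LeafOrderBlowup`) this places the controlled transform of `f` in the normal form that
✓ `leafSum_tower` iterates.  Honest framing: OURS (instantiation); the curve blow-ups of the tower and `Γ″` remain (census (S)); nothing here proves X44c, any case of
`CleanModels`, or resolution of singularities in characteristic `p`. [cite: CossartPiltant2008, Lemma 4.3 (5); Prop. 4.4 (proof, p. 11)] [cite: CossartJannsenSaito2020, Lemma 7.5]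
-/

noncomputable section

set_option linter.dupNamespace false -- mandated namespace of this single-conjunct summit

open IsLocalRing CategoryTheory AlgebraicGeometry
open Literature.AlgebraicGeometry.Resolution

namespace Summit.ResolutionOfSingularities.ResolutionOfSingularities.Theorems.RadicialJung.CleanModels

universe u

set_option maxHeartbeats 800000 in
-- normal form bookkeeping on stalks
/-- **The first division of the leaf tower on the stalks of a blowing up.**  See the module docstring. [cite: CossartPiltant2008, Prop. 4.4 (proof, p. 11)]
[cite: CossartJannsenSaito2020, Lemma 7.5] -/
theorem exists_chart_leafSum_of_isBlowup {X X' : Scheme.{u}} {τ : X' ⟶ X} {J : X.IdealSheafData} (hτ : IsBlowup τ J) (x' : X')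
    (hR : IsRegularLocalRing (X.presheaf.stalk (τ x'))) {n l : ℕ} (c : Fin n → X.presheaf.stalk (τ x')) (w : Fin l → X.presheaf.stalk (τ x'))
    (hz : Ideal.span (Set.range (Fin.append c w)) = maximalIdeal (X.presheaf.stalk (τ x')))
    (hdim : ringKrullDim (X.presheaf.stalk (τ x')) = ((n + l : ℕ) : WithBot ℕ∞))
    (hcJ : Ideal.span (Set.range c) = stalkIdeal J (τ x')) (i₀ : Fin n) (μ : ℕ) (k : ℕ → ℕ) (hk : ∀ e ≤ μ, μ ≤ e + k e)
    (G : ℕ → MvPolynomial (Fin n) (X.presheaf.stalk (τ x'))) (hG : ∀ e, (G e).IsHomogeneous (k e))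
    (r : ℕ → X.presheaf.stalk (τ x')) (hr : ∀ e, r e ∈ Ideal.span (Set.range c) ^ (k e + 1)) :
    ∃ (i : Fin n) (uf : Fin n → X'.presheaf.stalk x') (h : ℕ → X'.presheaf.stalk x'),
      (∀ j, (τ.stalkMap x').hom (c j) = (τ.stalkMap x').hom (c i) * uf j) ∧ uf i = 1 ∧
      (τ.stalkMap x').hom (∑ e ∈ Finset.range (μ + 1), c i₀ ^ e * (MvPolynomial.eval c (G e) + r e)) =
        (τ.stalkMap x').hom (c i) ^ μ *
          ∑ e ∈ Finset.range (μ + 1), uf i₀ ^ e * (τ.stalkMap x').hom (c i) ^ (e + k e - μ) * h e ∧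
      ∀ e, h e - MvPolynomial.eval₂ (τ.stalkMap x').hom uf (G e) ∈ Ideal.span {(τ.stalkMap x').hom (c i)} := by
  classical
  obtain ⟨i, uf, -, -, hrel, hufi, -⟩ :=
    exists_transform_normalForm_of_isBlowup hτ x' hR c w hz hdim hcJ (fun _ => 0) (fun _ => 0) isUnit_one
  set ψ := (τ.stalkMap x').hom with hψ
  set e' := ψ (c i) with he'
  -- each coefficient: `ψ(G_e(c) + r_e) = e'^{k_e} h_e`, `h_e ≡ G_e^ψ(uf) (mod e')`
  have hcoef : ∀ e, ∃ h : X'.presheaf.stalk x', ψ (MvPolynomial.eval c (G e) + r e) = e' ^ k e * h ∧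
      h - MvPolynomial.eval₂ ψ uf (G e) ∈ Ideal.span {e'} :=
    fun e => leafSum_base ψ c e' uf hrel (hG e) (hr e)
  choose h hh using hcoef
  refine ⟨i, uf, h, hrel, hufi, ?_, fun e => (hh e).2⟩
  -- `ψ f = Σ ψ(c_{i₀})^e ψ(g_e) = Σ (e' uf_{i₀})^e e'^{k_e} h_e = e'^μ Σ uf_{i₀}^e e'^{e+k_e-μ} h_e`
  rw [map_sum, Finset.mul_sum]
  refine Finset.sum_congr rfl fun e he => ?_
  have he2 : e ≤ μ := by simpa [Finset.mem_range, Nat.lt_succ_iff] using he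
  have hpow : e' ^ e * e' ^ k e = e' ^ μ * e' ^ (e + k e - μ) := by
    rw [← pow_add, ← pow_add]; congr 1; have := hk e he2; omega
  rw [map_mul, map_pow, hrel i₀, (hh e).1, mul_pow]
  calc e' ^ e * uf i₀ ^ e * (e' ^ k e * h e) = (e' ^ e * e' ^ k e) * (uf i₀ ^ e * h e) := by ring
    _ = (e' ^ μ * e' ^ (e + k e - μ)) * (uf i₀ ^ e * h e) := by rw [hpow]
    _ = e' ^ μ * (uf i₀ ^ e * e' ^ (e + k e - μ) * h e) := by ring

/-! ## Appended (hand-2 g20): the GENERAL division step on stalks (blowing up `Z_j = V(t_j, u₁, …)` at a point of the strict transform of the leaf) -/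

set_option maxHeartbeats 800000 in
-- normal form bookkeeping on stalks
/-- **A division step of the leaf tower on the stalks of a blowing up** (any centre containing the leaf parameter `t = c_{i₀}` and the old exceptional parameter
`v = c_{i₁}` among its adapted generators).  If `z` lies on the strict transform of the leaf in the strong sense `τ♯t ∈ (J_x𝒪_z)·𝔪_z`, then the chart index `i` of
✓ `exists_transform_normalForm_of_isBlowup` is not `i₀`, and for `f = Σ_{e≤μ} t^e v^{k_e} h_e` (`μ ≤ e + k_e`):
`τ♯f = e′^μ · Σ_{e≤μ} (uf_{i₀})^e · e′^{e+k_e−μ} · (uf_{i₁}^{k_e} τ♯h_e)` with `e′ = τ♯c_i`, `τ♯t = e′·uf_{i₀}`, `τ♯v = e′·uf_{i₁}` — in the `v`-chart (`i = i₁`,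
`uf_{i₁} = 1`) this is verbatim ✓ `map_leafSum_eq`, the self-reproduction of the normal form along the tower of memo 4e §2.5.
[cite: CossartPiltant2008, Prop. 4.4 (proof, p. 11)] [cite: CossartJannsenSaito2020, Lemma 7.5] -/
theorem exists_chart_leafSum_step_of_isBlowup {X X' : Scheme.{u}} {τ : X' ⟶ X} {J : X.IdealSheafData} (hτ : IsBlowup τ J) (x' : X')
    (hR : IsRegularLocalRing (X.presheaf.stalk (τ x'))) {n l : ℕ} (c : Fin n → X.presheaf.stalk (τ x')) (w : Fin l → X.presheaf.stalk (τ x'))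
    (hz : Ideal.span (Set.range (Fin.append c w)) = maximalIdeal (X.presheaf.stalk (τ x')))
    (hdim : ringKrullDim (X.presheaf.stalk (τ x')) = ((n + l : ℕ) : WithBot ℕ∞))
    (hcJ : Ideal.span (Set.range c) = stalkIdeal J (τ x')) (i₀ i₁ : Fin n)
    (hL : (τ.stalkMap x').hom (c i₀) ∈ (stalkIdeal J (τ x')).map (τ.stalkMap x').hom * maximalIdeal (X'.presheaf.stalk x'))
    (hJ0 : (stalkIdeal J (τ x')).map (τ.stalkMap x').hom ≠ ⊥)
    (μ : ℕ) (k : ℕ → ℕ) (hk : ∀ e ≤ μ, μ ≤ e + k e) (h : ℕ → X.presheaf.stalk (τ x')) :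
    ∃ (i : Fin n) (uf : Fin n → X'.presheaf.stalk x'), i ≠ i₀ ∧
      (∀ j, (τ.stalkMap x').hom (c j) = (τ.stalkMap x').hom (c i) * uf j) ∧ uf i = 1 ∧
      (τ.stalkMap x').hom (∑ e ∈ Finset.range (μ + 1), c i₀ ^ e * c i₁ ^ k e * h e) =
        (τ.stalkMap x').hom (c i) ^ μ *
          ∑ e ∈ Finset.range (μ + 1), uf i₀ ^ e * (τ.stalkMap x').hom (c i) ^ (e + k e - μ) * (uf i₁ ^ k e * (τ.stalkMap x').hom (h e)) := by
  classical
  obtain ⟨i, uf, -, -, hrel, hufi, -⟩ :=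
    exists_transform_normalForm_of_isBlowup hτ x' hR c w hz hdim hcJ (fun _ => 0) (fun _ => 0) isUnit_one
  set ψ := (τ.stalkMap x').hom with hψ
  set e' := ψ (c i) with he'
  -- the exceptional ideal is `(e′)`
  have hexc : (stalkIdeal J (τ x')).map ψ = Ideal.span {e'} := by
    rw [← hcJ, Ideal.map_span]
    apply le_antisymm
    · rw [Ideal.span_le]
      rintro _ ⟨_, ⟨j, rfl⟩, rfl⟩
      rw [SetLike.mem_coe, hrel j]
      exact Ideal.mul_mem_right _ _ (Ideal.mem_span_singleton_self _)
    · rw [Ideal.span_singleton_le_iff_mem]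
      exact Ideal.subset_span ⟨c i, ⟨i, rfl⟩, rfl⟩
  -- `i ≠ i₀`: otherwise `e′ ∈ (e′)𝔪`, forcing `e′ = 0`
  have hii₀ : i ≠ i₀ := by
    rintro rfl
    rw [hexc] at hL hJ0
    obtain ⟨m, hm, hme⟩ := Ideal.mem_span_singleton_mul.mp hL
    -- `e′ (1 − m) = 0` with `1 − m` a unit
    have h1 : e' * (1 - m) = 0 := by rw [mul_sub, mul_one, hme, sub_self]
    have hu : IsUnit (1 - m) := by
      apply IsLocalRing.isUnit_one_sub_self_of_mem_nonunits
      exact hm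
    have he0 : e' = 0 := by
      have := congrArg (· * hu.unit⁻¹.val) h1
      simpa [mul_assoc] using this
    apply hJ0
    rw [he0, Ideal.span_singleton_eq_bot]
  refine ⟨i, uf, hii₀, hrel, hufi, ?_⟩
  rw [map_sum, Finset.mul_sum]
  refine Finset.sum_congr rfl fun e he => ?_
  have he2 : e ≤ μ := by simpa [Finset.mem_range, Nat.lt_succ_iff] using he
  have hpow : e' ^ e * e' ^ k e = e' ^ μ * e' ^ (e + k e - μ) := by
    rw [← pow_add, ← pow_add]; congr 1; have := hk e he2; omega
  rw [map_mul, map_mul, map_pow, map_pow, hrel i₀, hrel i₁, mul_pow, mul_pow]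
  calc e' ^ e * uf i₀ ^ e * (e' ^ k e * uf i₁ ^ k e) * ψ (h e) = (e' ^ e * e' ^ k e) * (uf i₀ ^ e * (uf i₁ ^ k e * ψ (h e))) := by ring
    _ = (e' ^ μ * e' ^ (e + k e - μ)) * (uf i₀ ^ e * (uf i₁ ^ k e * ψ (h e))) := by rw [hpow]
    _ = e' ^ μ * (uf i₀ ^ e * e' ^ (e + k e - μ) * (uf i₁ ^ k e * ψ (h e))) := by ring

end Summit.ResolutionOfSingularities.ResolutionOfSingularities.Theorems.RadicialJung.CleanModels

end
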